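import Literature.Barriers.CriticalPhenomena.TimarSlabs
import Literature.Barriers.CriticalPhenomena.TimarLevelExhaustion
import Mathlib.MeasureTheory.Integral.IntervalIntegral.Periodic
import Mathlib.MeasureTheory.Function.Floor
import Mathlib.Analysis.SpecialFunctions.Pow.Real
import HarnessLib

/-!
# Timár 2006, §5: the 1-partition — a random, `Aut(G)`-invariant partition of the levels into
# slabs of width `μ` — PROVED

Barrier catalogue `Literature/Barriers/CriticalPhenomena/`; a brick of the programme proving
Timár's Thm. 5.5 (`Timar2006_finiteLevelUnion`, `TimarCriticalNonunimodular.lean`). Á. Timár,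
*Percolation on nonunimodular transitive graphs*, Ann. Probab. 34 (2006) 2344–2364, §5
(arXiv:math/0702875v1, pp. 13–14):

> "Let `μ` be the maximum of `w(x)/w(y)`, where `x` and `y` are adjacent vertices in `G`. Define
> the (random) *1-partition* of `G` as follows. Choose `U ∈ [0, 1]` uniformly at random and let `x`
> and `y ∈ V(G)` be in the same class of the partition iff `log_μ w(x)` and `log_μ w(y)` are in the
> same interval of the form `[n + U, n + 1 + U)`, `n ∈ ℤ`. Note that the 1-partition of `G` also
> partitions its levels. The idea of such a partition comes from Lyons, Peres and Schramm, and it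
> is essential in what follows. … The main difference is that here, we shall get a partition that
> is automorphism-invariant. … We shall call a set of the form `L = {x : μ^a < w(x) ≤ μ^b}` a *slab*
> if `a, b ∈ ℝ` and `b - a ≥ 1`. … Note that each class in the 1-partition is a slab."

This file constructs the 1-partition as an explicit random equivalence relation on the vertices,
parametrised by a point `θ` of the circle `ℝ/ℤ` (`UnitAddCircle`, Haar probability measure) —
`U` is the representative of `θ` in `[0, 1)` — together with the action of `Aut(G)` on the circle
by the rotations `θ ↦ θ + log_μ w(γ o)` through which the partition is invariant ("any
automorphism of `G` acts on the weights of the levels by multiplying them with a constant", §5),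
in the tree's vocabulary: weights `w = autWeight G o` (`TimarNonunimodularLevels.lean`),
`Δ = minNbrWeight G o` (`TimarLevelGrid.lean`; Timár's `μ` is `Δ⁻¹`, cf. `TimarSlabs.lean`) and
the slabs `weightSlab G o a b = {v : a < w(v) ≤ b}` of `TimarSlabs.lean`. To land the classes
EXACTLY on the tree's slabs `(a, b]` we use the intervals `(n - 1 + U, n + U]` of `log_μ w`
(ceilings) instead of the printed `[n + U, n + 1 + U)` (floors); the two conventions define the
same random partition up to relabelling the classes and reflecting `U`, and every statement of
§5 about the 1-partition ("each class is a slab", invariance, "partitions its levels") holds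
verbatim for either.

## Contents (namespace `Literature.Barriers.CriticalPhenomena`), for `G` connected, locally
finite, transitive and (where `μ > 1` is needed) nonunimodular

* `timarMu G o = (Δ⁻¹).toReal` — Timár's `μ > 1` (`one_lt_timarMu`), and the base-`μ` heights
  `logHeight G o x = log_μ w_o(x)` (`sameLevel_iff_logHeight_eq`, `logHeight_map`:
  `log_μ w(γ v) = log_μ w(v) + log_μ w(γ o)`);
* `unitLift θ ∈ [0, 1)` — the representative `U` of `θ : UnitAddCircle` (`unitLift_coe`:
  `unitLift ↑r = fract r`; `unitLift_add_coe`);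
* `oneIndex G o θ x = ⌈log_μ w(x) - U⌉` and the **1-partition** `OnePartitionRel G o θ`
  (`onePartitionRel_equivalence`), saturated with respect to the levels
  (`oneIndex_eq_of_sameLevel`), whose classes are the slabs
  `weightSlab G o (Δ b) b`, `b = μ^{n + U}` (`setOf_onePartitionRel_eq_weightSlab` — "each
  class in the 1-partition is a slab", with `a = Δ b`, the width hypothesis of `TimarSlabs.lean`);
* the action `onePartitionAct G o γ θ = θ + log_μ w(γ o)` of `Aut(G)` on the circle: compatible
  with composition (`onePartitionAct_trans`), measurable and measure-preserving for the Haar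
  probability measure (`measurePreserving_onePartitionAct`), and **the 1-partition is invariant**:
  `γ x ∼_{γ • θ} γ y ↔ x ∼_θ y` (`onePartitionRel_act_iff`, from `oneIndex_act`: all indices shift by
  the same integer);
* measurability of the events `{θ | x ∼_θ y}` (`measurableSet_setOf_onePartitionRel`);
* the packaged statement `Timar2006_onePartition`.

## References

* Á. Timár, Ann. Probab. 34 (2006) 2344–2364 (arXiv:math/0702875v1), §5: first paragraph
  (`μ`, the 1-partition, its invariance), the definition of slabs and "each class in the
  1-partition is a slab" (after Lemma 5.1), the paragraph before Prop. 5.4 (automorphisms act on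
  `log_μ w` by adding constants). [Timar2006]
* R. Lyons, Y. Peres, O. Schramm, Ann. Probab. 34 (2006) 1665–1692 (the origin of the tilted
  random partition, as credited by Timár). [LyonsPeresSchramm2006]
-/

noncomputable section

namespace Literature.Barriers.CriticalPhenomena

open _root_.MeasureTheory _root_.Filter _root_.Topology
open Literature.Probability.LatticeModels Literature.Probability.Percolation

open scoped _root_.ENNReal

variable {V : Type*}

/-! ### Timár's `μ` and the base-`μ` heights -/

/-- **Timár's `μ`**: "the maximum of `w(x)/w(y)`, where `x` and `y` are adjacent vertices in `G`",
i.e. `Δ⁻¹` for the least neighbour weight `Δ = minNbrWeight G o` (the set of edge ratios is closed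
under inversion, cf. `TimarSlabs.lean`), as a real number. [cite: Timar2006, §5 (first paragraph: μ)] -/
def timarMu (G : SimpleGraph V) [G.LocallyFinite] (o : V) : ℝ := ((minNbrWeight G o)⁻¹).toReal

/-- `μ > 1` on a connected, locally finite, transitive nonunimodular graph (`Δ < 1`).
[cite: Timar2006, §5 (first paragraph)] -/
theorem one_lt_timarMu {G : SimpleGraph V} [G.LocallyFinite] (hconn : G.Connected)
    (ht : IsGraphTransitive G) (hU : ¬ IsGraphUnimodular G) (o : V) : 1 < timarMu G o := by
  rw [timarMu]
  have h1 : minNbrWeight G o < 1 := minNbrWeight_lt_one hconn ht hU o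
  have h0 : minNbrWeight G o ≠ 0 := minNbrWeight_ne_zero hconn o
  have hinv : 1 < (minNbrWeight G o)⁻¹ := ENNReal.one_lt_inv.2 h1
  have hinvT : (minNbrWeight G o)⁻¹ ≠ ⊤ := ENNReal.inv_ne_top.2 h0
  have := (ENNReal.toReal_lt_toReal ENNReal.one_ne_top hinvT).2 hinv
  simpa using this

/-- `μ > 0`. [folklore] -/
theorem timarMu_pos {G : SimpleGraph V} [G.LocallyFinite] (hconn : G.Connected)
    (ht : IsGraphTransitive G) (hU : ¬ IsGraphUnimodular G) (o : V) : 0 < timarMu G o :=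
  one_pos.trans (one_lt_timarMu hconn ht hU o)

/-- `log μ > 0`. [folklore] -/
theorem log_timarMu_pos {G : SimpleGraph V} [G.LocallyFinite] (hconn : G.Connected)
    (ht : IsGraphTransitive G) (hU : ¬ IsGraphUnimodular G) (o : V) : 0 < Real.log (timarMu G o) :=
  Real.log_pos (one_lt_timarMu hconn ht hU o)

/-- `μ⁻¹ = Δ` (as real numbers). [folklore] -/
theorem inv_timarMu {G : SimpleGraph V} [G.LocallyFinite] (o : V) :
    (timarMu G o)⁻¹ = (minNbrWeight G o).toReal := by
  rw [timarMu, ENNReal.toReal_inv, inv_inv]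

/-- The **base-`μ` height** `log_μ w_o(x)` of a vertex: the natural-log height `levelHeight`
of `TimarLevelExhaustion.lean` rescaled by `log μ`. [cite: Timar2006, §5 (log_μ w(x))] -/
def logHeight (G : SimpleGraph V) [G.LocallyFinite] (o x : V) : ℝ :=
  levelHeight G o x / Real.log (timarMu G o)

/-- Unfolding down to the weights. [folklore] -/
theorem logHeight_eq (G : SimpleGraph V) [G.LocallyFinite] (o x : V) :
    logHeight G o x = Real.log (autWeight G o x).toReal / Real.log (timarMu G o) := rfl

/-- The base vertex has height `0`. [folklore] -/
theorem logHeight_self {G : SimpleGraph V} [G.LocallyFinite] (hconn : G.Connected) (o : V) :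
    logHeight G o o = 0 := by
  rw [logHeight, levelHeight_self G hconn o, zero_div]

/-- `w(x) = μ ^ (log_μ w(x))`. [folklore] -/
theorem toReal_autWeight_eq_rpow {G : SimpleGraph V} [G.LocallyFinite] (hconn : G.Connected)
    (ht : IsGraphTransitive G) (hU : ¬ IsGraphUnimodular G) (o x : V) :
    (autWeight G o x).toReal = timarMu G o ^ logHeight G o x := by
  rw [Real.rpow_def_of_pos (timarMu_pos hconn ht hU o), logHeight_eq,
    mul_div_cancel₀ _ (log_timarMu_pos hconn ht hU o).ne', Real.exp_log (toReal_autWeight_pos G hconn o x)]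

/-- **Same level iff same base-`μ` height** ("two vertices are on the same level if and only if
their weights are the same"). [cite: Timar2006, §2 and §5 ("the 1-partition of G also partitions its levels")] -/
theorem sameLevel_iff_logHeight_eq {G : SimpleGraph V} [G.LocallyFinite] (hconn : G.Connected)
    (ht : IsGraphTransitive G) (hU : ¬ IsGraphUnimodular G) (o x y : V) :
    SameLevel G x y ↔ logHeight G o x = logHeight G o y := by
  rw [sameLevel_iff_autWeight_eq G hconn o]
  constructor
  · intro h; rw [logHeight_eq, logHeight_eq, h]
  · intro h
    have h' : (autWeight G o x).toReal = (autWeight G o y).toReal := by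
      rw [toReal_autWeight_eq_rpow hconn ht hU o x, toReal_autWeight_eq_rpow hconn ht hU o y, h]
    exact (ENNReal.toReal_eq_toReal_iff' (autWeight_ne_top G hconn o x) (autWeight_ne_top G hconn o y)).1 h'

/-- **Automorphisms shift all base-`μ` heights by one constant**: `log_μ w(γ v) = log_μ w(v) + log_μ w(γ o)`
("any automorphism of `G` acts on the weights of the levels by multiplying them with a
constant"). [cite: Timar2006, §5 (paragraph before Prop. 5.4)] -/
theorem logHeight_map {G : SimpleGraph V} [G.LocallyFinite] (hconn : G.Connected) (γ : G ≃g G)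
    (o v : V) : logHeight G o (γ v) = logHeight G o v + logHeight G o (γ o) := by
  rw [logHeight, logHeight, logHeight, levelHeight_map G hconn γ o v, add_div]

/-! ### The random parameter: a point of the circle `ℝ/ℤ` and its representative in `[0, 1)` -/

/-- The Haar measure of the unit circle `ℝ/ℤ` is a probability measure. [folklore] -/
instance isProbabilityMeasure_volume_unitAddCircle :
    IsProbabilityMeasure (volume : Measure UnitAddCircle) :=
  ⟨UnitAddCircle.measure_univ⟩

/-- The representative `U ∈ [0, 1)` of a point of the circle ("Choose `U ∈ [0, 1]` uniformly at
random"). [cite: Timar2006, §5 (first paragraph)] -/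
def unitLift (θ : UnitAddCircle) : ℝ := (AddCircle.equivIco (1 : ℝ) 0 θ : ℝ)

/-- `U ∈ [0, 1)`. [folklore] -/
theorem unitLift_mem_Ico (θ : UnitAddCircle) : unitLift θ ∈ Set.Ico (0 : ℝ) 1 := by
  have h := (AddCircle.equivIco (1 : ℝ) 0 θ).2
  simp only [zero_add] at h
  exact h

/-- The representative of `↑r` is the fractional part of `r`. [folklore] -/
theorem unitLift_coe (r : ℝ) : unitLift ((r : ℝ) : UnitAddCircle) = Int.fract r := by
  have h := AddCircle.coe_equivIco_mk_apply (p := (1 : ℝ)) r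
  simp only [div_one, mul_one] at h
  exact h

/-- `↑U = θ`. [folklore] -/
theorem coe_unitLift (θ : UnitAddCircle) : ((unitLift θ : ℝ) : UnitAddCircle) = θ :=
  AddCircle.coe_equivIco

/-- **Rotating the circle changes the representative by the rotation angle minus an integer**:
`U(θ + t) = U(θ) + t - ⌊U(θ) + t⌋`. [folklore] -/
theorem unitLift_add_coe (θ : UnitAddCircle) (t : ℝ) :
    unitLift (θ + ((t : ℝ) : UnitAddCircle)) = unitLift θ + t - ⌊unitLift θ + t⌋ := by
  have h : θ + ((t : ℝ) : UnitAddCircle) = (((unitLift θ + t : ℝ)) : UnitAddCircle) := by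
    rw [AddCircle.coe_add, coe_unitLift]
  rw [h, unitLift_coe, Int.fract]

/-- The representative is a measurable function of the point of the circle. [folklore] -/
theorem measurable_unitLift : Measurable unitLift :=
  measurable_subtype_coe.comp (AddCircle.measurableEquivIco (1 : ℝ) 0).measurable

/-! ### The 1-partition -/

section OnePartition

variable (G : SimpleGraph V) [G.LocallyFinite] (o : V)

/-- The **class index** of a vertex in the 1-partition with parameter `θ`: `⌈log_μ w(x) - U⌉`
(the printed classes `[n + U, n + 1 + U)` of `log_μ w`, here `(n - 1 + U, n + U]` so that classes
are the tree's slabs `(a, b]`; see the module docstring). [cite: Timar2006, §5 (the 1-partition)] -/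
def oneIndex (θ : UnitAddCircle) (x : V) : ℤ := ⌈logHeight G o x - unitLift θ⌉

/-- **The 1-partition** with parameter `θ`: `x` and `y` are in the same class iff `log_μ w(x)` and
`log_μ w(y)` lie in the same unit interval of the grid shifted by `U`.
[cite: Timar2006, §5 (the 1-partition)] -/
def OnePartitionRel (θ : UnitAddCircle) (x y : V) : Prop := oneIndex G o θ x = oneIndex G o θ y

/-- The 1-partition is a partition (the kernel of the class index). [cite: Timar2006, §5 (the 1-partition)] -/
theorem onePartitionRel_equivalence (θ : UnitAddCircle) : Equivalence (OnePartitionRel G o θ) :=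
  ⟨fun _ => rfl, fun h => h.symm, fun h₁ h₂ => h₁.trans h₂⟩

/-- Unfolding. [folklore] -/
theorem onePartitionRel_iff {θ : UnitAddCircle} {x y : V} :
    OnePartitionRel G o θ x y ↔ oneIndex G o θ x = oneIndex G o θ y := Iff.rfl

variable {G o}

/-- **"The 1-partition of `G` also partitions its levels"**: the class index only depends on the
level. [cite: Timar2006, §5 (first paragraph)] -/
theorem oneIndex_eq_of_sameLevel (hconn : G.Connected) (ht : IsGraphTransitive G)
    (hU : ¬ IsGraphUnimodular G) (θ : UnitAddCircle) {x y : V} (h : SameLevel G x y) :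
    oneIndex G o θ x = oneIndex G o θ y := by
  rw [oneIndex, oneIndex, (sameLevel_iff_logHeight_eq hconn ht hU o x y).1 h]

/-- Vertices on a common level are in a common class. [cite: Timar2006, §5 (first paragraph)] -/
theorem onePartitionRel_of_sameLevel (hconn : G.Connected) (ht : IsGraphTransitive G)
    (hU : ¬ IsGraphUnimodular G) (θ : UnitAddCircle) {x y : V} (h : SameLevel G x y) :
    OnePartitionRel G o θ x y :=
  oneIndex_eq_of_sameLevel hconn ht hU θ h

/-- The classes are saturated with respect to the levels. [cite: Timar2006, §5 (first paragraph)] -/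
theorem onePartitionRel_of_sameLevel_left (hconn : G.Connected) (ht : IsGraphTransitive G)
    (hU : ¬ IsGraphUnimodular G) {θ : UnitAddCircle} {x x' y : V} (hx : SameLevel G x x')
    (h : OnePartitionRel G o θ x y) : OnePartitionRel G o θ x' y :=
  (oneIndex_eq_of_sameLevel hconn ht hU θ hx).symm.trans h

/-! #### Each class is a slab -/

/-- `log_μ w(y) ≤ c ↔ w(y) ≤ μ^c`. [folklore] -/
theorem logHeight_le_iff (hconn : G.Connected) (ht : IsGraphTransitive G) (hU : ¬ IsGraphUnimodular G)
    (y : V) (c : ℝ) : logHeight G o y ≤ c ↔ (autWeight G o y).toReal ≤ timarMu G o ^ c := by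
  rw [toReal_autWeight_eq_rpow hconn ht hU o y,
    Real.rpow_le_rpow_left_iff (one_lt_timarMu hconn ht hU o)]

/-- `c < log_μ w(y) ↔ μ^c < w(y)`. [folklore] -/
theorem lt_logHeight_iff (hconn : G.Connected) (ht : IsGraphTransitive G) (hU : ¬ IsGraphUnimodular G)
    (y : V) (c : ℝ) : c < logHeight G o y ↔ timarMu G o ^ c < (autWeight G o y).toReal := by
  rw [toReal_autWeight_eq_rpow hconn ht hU o y,
    Real.rpow_lt_rpow_left_iff (one_lt_timarMu hconn ht hU o)]

/-- The upper end `b = μ^{n + U}` of the class with index `n`, as an extended nonnegative real.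
[cite: Timar2006, §5 ("each class in the 1-partition is a slab")] -/
def oneClassTop (G : SimpleGraph V) [G.LocallyFinite] (o : V) (θ : UnitAddCircle) (n : ℤ) : ℝ≥0∞ :=
  ENNReal.ofReal (timarMu G o ^ ((n : ℝ) + unitLift θ))

/-- `b ≠ 0`. [folklore] -/
theorem oneClassTop_ne_zero (hconn : G.Connected) (ht : IsGraphTransitive G)
    (hU : ¬ IsGraphUnimodular G) (θ : UnitAddCircle) (n : ℤ) : oneClassTop G o θ n ≠ 0 := by
  rw [oneClassTop, ne_eq, ENNReal.ofReal_eq_zero, not_le]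
  exact Real.rpow_pos_of_pos (timarMu_pos hconn ht hU o) _

/-- `b ≠ ⊤`. [folklore] -/
theorem oneClassTop_ne_top (θ : UnitAddCircle) (n : ℤ) : oneClassTop G o θ n ≠ ⊤ :=
  ENNReal.ofReal_ne_top

/-- The lower end of the class with index `n` is `Δ b`: `μ^{n - 1 + U} = Δ μ^{n + U}`. [folklore] -/
theorem ofReal_rpow_sub_one (hconn : G.Connected) (ht : IsGraphTransitive G)
    (hU : ¬ IsGraphUnimodular G) (θ : UnitAddCircle) (n : ℤ) :
    ENNReal.ofReal (timarMu G o ^ ((n : ℝ) - 1 + unitLift θ)) =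
      minNbrWeight G o * oneClassTop G o θ n := by
  have hμ := timarMu_pos hconn ht hU o
  have h : timarMu G o ^ ((n : ℝ) - 1 + unitLift θ) =
      (minNbrWeight G o).toReal * timarMu G o ^ ((n : ℝ) + unitLift θ) := by
    rw [show (n : ℝ) - 1 + unitLift θ = ((n : ℝ) + unitLift θ) + (-1) by ring,
      Real.rpow_add hμ, Real.rpow_neg_one, inv_timarMu, mul_comm]
  rw [h, ENNReal.ofReal_mul ENNReal.toReal_nonneg, oneClassTop,
    ENNReal.ofReal_toReal (minNbrWeight_ne_top hconn ht hU o)]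

/-- **"Each class in the 1-partition is a slab"**: the class of `x` (index `n = ⌈log_μ w(x) - U⌉`)
is the slab `{v : Δ b < w(v) ≤ b}` with `b = μ^{n + U}` — a slab of `TimarSlabs.lean` with the
width hypothesis `a ≤ Δ b` satisfied with equality.
[cite: Timar2006, §5 ("Note that each class in the 1-partition is a slab")] -/
theorem setOf_onePartitionRel_eq_weightSlab (hconn : G.Connected) (ht : IsGraphTransitive G)
    (hU : ¬ IsGraphUnimodular G) (θ : UnitAddCircle) (x : V) :
    {y | OnePartitionRel G o θ x y} =
      weightSlab G o (minNbrWeight G o * oneClassTop G o θ (oneIndex G o θ x))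
        (oneClassTop G o θ (oneIndex G o θ x)) := by
  ext y
  set n : ℤ := oneIndex G o θ x with hn
  rw [Set.mem_setOf_eq, mem_weightSlab, onePartitionRel_iff, ← hn, eq_comm, oneIndex, Int.ceil_eq_iff,
    ← ofReal_rpow_sub_one hconn ht hU θ n, oneClassTop]
  have hyT := autWeight_ne_top G hconn o y
  have h1 : (↑n - 1 < logHeight G o y - unitLift θ) ↔
      ENNReal.ofReal (timarMu G o ^ ((n : ℝ) - 1 + unitLift θ)) < autWeight G o y := by
    rw [show (↑n - 1 < logHeight G o y - unitLift θ) ↔ ((n : ℝ) - 1 + unitLift θ < logHeight G o y) by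
        constructor <;> intro h <;> linarith,
      lt_logHeight_iff hconn ht hU y, ENNReal.ofReal_lt_iff_lt_toReal (Real.rpow_nonneg
        (timarMu_pos hconn ht hU o).le _) hyT]
  have h2 : (logHeight G o y - unitLift θ ≤ ↑n) ↔
      autWeight G o y ≤ ENNReal.ofReal (timarMu G o ^ ((n : ℝ) + unitLift θ)) := by
    rw [show (logHeight G o y - unitLift θ ≤ ↑n) ↔ (logHeight G o y ≤ (n : ℝ) + unitLift θ) by
        constructor <;> intro h <;> linarith,
      logHeight_le_iff hconn ht hU y, ← ENNReal.ofReal_toReal hyT,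
      ENNReal.ofReal_le_ofReal_iff (Real.rpow_nonneg (timarMu_pos hconn ht hU o).le _),
      ENNReal.ofReal_toReal hyT]
  rw [h1, h2]

/-- Hence every class of the 1-partition is a slab `weightSlab G o (Δ b) b` for some
`b ∈ (0, ∞)`. [cite: Timar2006, §5 ("each class in the 1-partition is a slab")] -/
theorem exists_setOf_onePartitionRel_eq_weightSlab (hconn : G.Connected) (ht : IsGraphTransitive G)
    (hU : ¬ IsGraphUnimodular G) (θ : UnitAddCircle) (x : V) :
    ∃ b : ℝ≥0∞, b ≠ 0 ∧ b ≠ ⊤ ∧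
      {y | OnePartitionRel G o θ x y} = weightSlab G o (minNbrWeight G o * b) b :=
  ⟨_, oneClassTop_ne_zero hconn ht hU θ _, oneClassTop_ne_top θ _,
    setOf_onePartitionRel_eq_weightSlab hconn ht hU θ x⟩

/-! #### The action of `Aut(G)` and invariance -/

variable (G o) in
/-- **The action of `Aut(G)` on the parameter**: the rotation of the circle by `log_μ w(γ o)`, the
constant by which `γ` shifts all base-`μ` heights. [cite: Timar2006, §5 (invariance of the 1-partition; paragraph before Prop. 5.4)] -/
def onePartitionAct (γ : G ≃g G) (θ : UnitAddCircle) : UnitAddCircle :=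
  θ + ((logHeight G o (γ o) : ℝ) : UnitAddCircle)

/-- The action is compatible with composition: `(γ' ∘ γ) • θ = γ' • (γ • θ)`. [folklore] -/
theorem onePartitionAct_trans (hconn : G.Connected) (γ γ' : G ≃g G) (θ : UnitAddCircle) :
    onePartitionAct G o (γ.trans γ') θ = onePartitionAct G o γ' (onePartitionAct G o γ θ) := by
  simp only [onePartitionAct]
  change θ + ((logHeight G o (γ' (γ o)) : ℝ) : UnitAddCircle) = _
  rw [logHeight_map hconn γ' o (γ o), AddCircle.coe_add, add_assoc]

/-- The identity acts trivially. [folklore] -/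
@[simp] theorem onePartitionAct_refl (hconn : G.Connected) (θ : UnitAddCircle) :
    onePartitionAct G o (RelIso.refl _) θ = θ := by
  simp only [onePartitionAct]
  change θ + ((logHeight G o o : ℝ) : UnitAddCircle) = θ
  rw [logHeight_self hconn o, AddCircle.coe_zero, add_zero]

/-- The action is measurable … [folklore] -/
theorem measurable_onePartitionAct (γ : G ≃g G) : Measurable (onePartitionAct G o γ) :=
  measurable_add_const _

/-- … and preserves the Haar probability measure of the circle ("Choose `U ∈ [0, 1]` uniformly at
random": the law of the parameter is invariant under the action). [cite: Timar2006, §5 (invariance of the 1-partition)] -/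
theorem measurePreserving_onePartitionAct (γ : G ≃g G) :
    MeasurePreserving (onePartitionAct G o γ) (volume : Measure UnitAddCircle) volume :=
  measurePreserving_add_right volume _

/-- **All class indices shift by the same integer** when `γ` is applied to the vertices and the
parameter is rotated accordingly: `n(γ • θ, γ x) = n(θ, x) + ⌊U + log_μ w(γ o)⌋`.
[cite: Timar2006, §5 (invariance of the 1-partition)] -/
theorem oneIndex_act (hconn : G.Connected) (γ : G ≃g G) (θ : UnitAddCircle) (x : V) :
    oneIndex G o (onePartitionAct G o γ θ) (γ x) =
      oneIndex G o θ x + ⌊unitLift θ + logHeight G o (γ o)⌋ := by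
  rw [oneIndex, oneIndex, onePartitionAct, unitLift_add_coe, logHeight_map hconn γ o x]
  have h : logHeight G o x + logHeight G o (γ o) -
      (unitLift θ + logHeight G o (γ o) - (⌊unitLift θ + logHeight G o (γ o)⌋ : ℝ)) =
      logHeight G o x - unitLift θ + ((⌊unitLift θ + logHeight G o (γ o)⌋ : ℤ) : ℝ) := by ring
  rw [h, Int.ceil_add_intCast]

/-- **The 1-partition is `Aut(G)`-invariant**: `γ x` and `γ y` are in a common class for the
rotated parameter iff `x` and `y` are for the original one ("here, we shall get a partition that
is automorphism-invariant"). [cite: Timar2006, §5 (invariance of the 1-partition)] -/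
theorem onePartitionRel_act_iff (hconn : G.Connected) (γ : G ≃g G) (θ : UnitAddCircle) (x y : V) :
    OnePartitionRel G o (onePartitionAct G o γ θ) (γ x) (γ y) ↔ OnePartitionRel G o θ x y := by
  rw [onePartitionRel_iff, onePartitionRel_iff, oneIndex_act hconn, oneIndex_act hconn, add_left_inj]

/-! #### Measurability in the parameter -/

/-- The class index is a measurable function of the parameter. [folklore] -/
theorem measurable_oneIndex (x : V) : Measurable fun θ : UnitAddCircle => oneIndex G o θ x :=
  Int.measurable_ceil.comp (measurable_const.sub measurable_unitLift)

/-- The events "`x ∼_θ y`" are measurable in the parameter. [folklore] -/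
theorem measurableSet_setOf_onePartitionRel (x y : V) :
    MeasurableSet {θ : UnitAddCircle | OnePartitionRel G o θ x y} :=
  measurableSet_eq_fun (measurable_oneIndex x) (measurable_oneIndex y)

end OnePartition

/-- **Timár 2006, §5: the 1-partition, PROVED (packaged).** On a connected, locally finite,
transitive, nonunimodular graph there is a probability space (the circle with its Haar measure)
carrying an action of `Aut(G)` by measure-preserving maps and a random equivalence relation on
the vertices — the 1-partition — which is saturated with respect to the levels, whose classes are
slabs `{v : Δ b < w(v) ≤ b}` (`0 < b < ∞`; width exactly Timár's `μ = Δ⁻¹`), and which is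
invariant: `γ x ∼_{γ • θ} γ y ↔ x ∼_θ y`.
[cite: Timar2006, §5 (the 1-partition; "each class in the 1-partition is a slab")] -/
theorem Timar2006_onePartition {V : Type*} (G : SimpleGraph V) [G.LocallyFinite]
    (hconn : G.Connected) (ht : IsGraphTransitive G) (hU : ¬ IsGraphUnimodular G) (o : V) :
    ∃ (Ω : Type) (_ : MeasurableSpace Ω) (P : Measure Ω) (_ : IsProbabilityMeasure P)
      (act : (G ≃g G) → Ω → Ω) (rel : Ω → V → V → Prop),
      (∀ γ γ', act (γ.trans γ') = act γ' ∘ act γ) ∧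
      (∀ γ, MeasurePreserving (act γ) P P) ∧
      (∀ θ, Equivalence (rel θ)) ∧
      (∀ θ x y, SameLevel G x y → rel θ x y) ∧
      (∀ θ x, ∃ b : ℝ≥0∞, b ≠ 0 ∧ b ≠ ⊤ ∧ {y | rel θ x y} = weightSlab G o (minNbrWeight G o * b) b) ∧
      (∀ θ γ x y, rel (act γ θ) (γ x) (γ y) ↔ rel θ x y) ∧
      (∀ x y, MeasurableSet {θ | rel θ x y}) :=
  ⟨UnitAddCircle, inferInstance, volume, inferInstance, onePartitionAct G o, OnePartitionRel G o,
    fun γ γ' => funext (onePartitionAct_trans hconn γ γ'),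
    measurePreserving_onePartitionAct,
    onePartitionRel_equivalence G o,
    fun θ _ _ h => onePartitionRel_of_sameLevel hconn ht hU θ h,
    exists_setOf_onePartitionRel_eq_weightSlab hconn ht hU,
    fun θ γ x y => onePartitionRel_act_iff hconn γ θ x y,
    measurableSet_setOf_onePartitionRel⟩

end Literature.Barriers.CriticalPhenomena

end
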